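import Mathlib.MeasureTheory.Integral.Bochner.Set
import Mathlib.Topology.UniformSpace.UniformConvergence
import HarnessLib

/-!
# `∫∫ Dᵢ(y₁, y₂) dνᵢ(y₂) dμᵢ(y₁) → D(x₁, x₂)` when `μᵢ → δ_{x₁}`, `νᵢ → δ_{x₂}` weakly and
# `Dᵢ → D` uniformly (the limit behind Bamler 2020a, Cor. 3.7 / 9:
# `Var_t(ν_{x₁,t₀;t}, ν_{x₂,t₀;t}) → d²_{t₀}(x₁, x₂)` as `t ↗ t₀`)

R. Bamler, *Entropy and heat kernel bounds on a Ricci flow background*, arXiv:2008.07093 (2020a),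
proof of Cor. 9: "`lim_{t ↗ t₀} Var_t(ν_{x₁,t₀;t}, ν_{x₂,t₀;t}) = Var_{t₀}(δ_{x₁}, δ_{x₂}) =
d²_{t₀}(x₁, x₂)`". The abstract content: on a compact space `X`, if
probability measures `μᵢ`, `νᵢ` converge weakly (against continuous functions) to `δ_{x₁}`,
`δ_{x₂}` along a filter, `D : X × X → ℝ` is continuous and `Dᵢ → D` uniformly, then
`∫∫ Dᵢ(y₁, y₂) dνᵢ(y₂) dμᵢ(y₁) → D(x₁, x₂)`:

* `tendsto_integral_integral_of_tendsto_dirac` — the statement;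
* `tendstoUniformly_integral_of_tendsto_dirac` — the inner step: `y₁ ↦ ∫ D(y₁, ·) dνᵢ` converges
  to `y₁ ↦ D(y₁, x₂)` UNIFORMLY (equicontinuity from the uniform continuity of `D` on the compact
  `X × X`, pointwise convergence at the points of a finite cover).

Everything is proved; no definitions, no named facts.

## References

* R. H. Bamler, *Entropy and heat kernel bounds on a Ricci flow background*, arXiv:2008.07093
  (2020), §3.2, proof of Cor. 9.
* P. Billingsley, *Convergence of probability measures*, 2nd ed. (1999), §2 (weak convergence).
-/

noncomputable section

open Set Filter Topology
open _root_.MeasureTheory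

namespace Literature.MeasureTheory.Integral

variable {X : Type*} [TopologicalSpace X] [CompactSpace X]
  [MeasurableSpace X] [OpensMeasurableSpace X]

omit [MeasurableSpace X] [OpensMeasurableSpace X] in
/-- Tube lemma: slices of a continuous function on `X × Y`, `X` compact, vary uniformly
continuously in the parameter. [folklore] -/
theorem eventually_forall_abs_sub_lt {Y : Type*} [TopologicalSpace Y] {Φ : X × Y → ℝ}
    (hΦ : Continuous Φ) (y₀ : Y) {ε : ℝ} (hε : 0 < ε) :
    ∀ᶠ y in 𝓝 y₀, ∀ z, |Φ (z, y) - Φ (z, y₀)| < ε := by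
  set n : Set (X × Y) := {p | |Φ p - Φ (p.1, y₀)| < ε}
  have hn : IsOpen n := isOpen_lt (by fun_prop) continuous_const
  have hp : (univ : Set X) ×ˢ ({y₀} : Set Y) ⊆ n := by
    rintro ⟨z, y⟩ ⟨-, hy⟩
    rw [mem_singleton_iff] at hy
    subst hy
    simpa [n] using hε
  obtain ⟨u, w, -, hw, hu, hy₀w, huw⟩ :=
    generalized_tube_lemma isCompact_univ isCompact_singleton hn hp
  filter_upwards [hw.mem_nhds (hy₀w (mem_singleton y₀))] with y hy z
  exact huw ⟨hu (mem_univ z), hy⟩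

omit [TopologicalSpace X] [CompactSpace X] [OpensMeasurableSpace X] in
/-- Integrals of a bounded function against probability measures are bounded. [folklore] -/
theorem abs_integral_le_of_forall_abs_le (μ : Measure X) [IsProbabilityMeasure μ] {f : X → ℝ}
    {C : ℝ} (hf : ∀ x, |f x| ≤ C) : |∫ x, f x ∂μ| ≤ C := by
  have h := norm_integral_le_of_norm_le_const (μ := μ) (f := f) (C := C)
    (Eventually.of_forall fun x ↦ (Real.norm_eq_abs _).trans_le (hf x))
  rwa [probReal_univ, mul_one, Real.norm_eq_abs] at h

/-- A parametric integral `y₁ ↦ ∫ D(y₁, y₂) dν(y₂)` of a continuous `D` on the compact `X × X`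
against a finite measure is continuous (tube lemma). [folklore] -/
theorem continuous_integral_of_continuous_prod (ν : Measure X) [IsFiniteMeasure ν] {D : X × X → ℝ}
    (hD : Continuous D) : Continuous fun y₁ ↦ ∫ y₂, D (y₁, y₂) ∂ν := by
  have hD' : Continuous fun q : X × X ↦ D (q.2, q.1) := hD.comp (continuous_snd.prodMk continuous_fst)
  have hint : ∀ y₁, Integrable (fun y₂ ↦ D (y₁, y₂)) ν := fun y₁ ↦
    (hD.comp (continuous_const.prodMk continuous_id)).integrable_of_hasCompactSupport
      (HasCompactSupport.of_compactSpace _)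
  refine continuous_iff_continuousAt.2 fun y₁ ↦ ?_
  rw [ContinuousAt, Metric.tendsto_nhds]
  intro ε hε
  have hδ : 0 < ε / (ν.real univ + 1) := by positivity
  have hev := eventually_forall_abs_sub_lt (Φ := fun q : X × X ↦ D (q.2, q.1)) hD' y₁ hδ
  filter_upwards [hev] with y hy
  rw [Real.dist_eq, ← integral_sub (hint y) (hint y₁)]
  have hb := norm_integral_le_of_norm_le_const (μ := ν) (f := fun y₂ ↦ D (y, y₂) - D (y₁, y₂))
    (C := ε / (ν.real univ + 1)) (Eventually.of_forall fun y₂ ↦ by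
      rw [Real.norm_eq_abs]; exact (hy y₂).le)
  rw [Real.norm_eq_abs] at hb
  refine hb.trans_lt ?_
  rw [div_mul_eq_mul_div, div_lt_iff₀ (by positivity)]
  nlinarith [measureReal_nonneg (μ := ν) (s := univ)]

/-- **Uniform convergence of the inner integrals**: if `νᵢ → δ_{x₂}` weakly (against continuous
functions) and `D : X × X → ℝ` is continuous on the compact `X × X`, then
`y₁ ↦ ∫ D(y₁, y₂) dνᵢ(y₂)` converges to `y₁ ↦ D(y₁, x₂)` uniformly (equicontinuity + pointwise
convergence at finitely many points). [folklore] -/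
theorem tendstoUniformly_integral_of_tendsto_dirac {ι : Type*} {l : Filter ι}
    {ν : ι → Measure X} [∀ i, IsProbabilityMeasure (ν i)] {x₂ : X}
    (hν : ∀ φ : X → ℝ, Continuous φ → Tendsto (fun i ↦ ∫ y, φ y ∂ν i) l (𝓝 (φ x₂)))
    {D : X × X → ℝ} (hD : Continuous D) :
    TendstoUniformly (fun i y₁ ↦ ∫ y₂, D (y₁, y₂) ∂ν i) (fun y₁ ↦ D (y₁, x₂)) l := by
  rw [Metric.tendstoUniformly_iff]
  intro ε hε
  have hε3 : 0 < ε / 3 := by positivity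
  -- equicontinuity neighbourhoods `U y₁` with `|D(z, y₂) - D(y₁, y₂)| < ε/3` for `z ∈ U y₁`, all `y₂`
  have hD' : Continuous fun q : X × X ↦ D (q.2, q.1) := hD.comp (continuous_snd.prodMk continuous_fst)
  have hU : ∀ y₁ : X, ∃ U ∈ 𝓝 y₁, ∀ z ∈ U, ∀ y₂, |D (z, y₂) - D (y₁, y₂)| < ε / 3 := by
    intro y₁
    have hev := eventually_forall_abs_sub_lt (Φ := fun q : X × X ↦ D (q.2, q.1)) hD' y₁ hε3
    exact ⟨{z | ∀ y₂, |D (z, y₂) - D (y₁, y₂)| < ε / 3}, hev, fun z hz ↦ hz⟩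
  choose U hUn hUε using hU
  obtain ⟨s, -, hcover⟩ := isCompact_univ.elim_nhds_subcover U fun y₁ _ ↦ hUn y₁
  -- pointwise convergence at the finitely many centres
  have hpt : ∀ᶠ i in l, ∀ y₁ ∈ s, |(∫ y₂, D (y₁, y₂) ∂ν i) - D (y₁, x₂)| < ε / 3 := by
    have : ∀ y₁ ∈ s, ∀ᶠ i in l, |(∫ y₂, D (y₁, y₂) ∂ν i) - D (y₁, x₂)| < ε / 3 := by
      intro y₁ _
      have h1 := hν (fun y₂ ↦ D (y₁, y₂)) (hD.comp (continuous_const.prodMk continuous_id))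
      rw [Metric.tendsto_nhds] at h1
      simpa only [Real.dist_eq] using h1 (ε / 3) hε3
    exact (s.eventually_all).2 this
  filter_upwards [hpt] with i hi y₁
  obtain ⟨c, hcs, hyc⟩ : ∃ c ∈ s, y₁ ∈ U c := by
    simpa only [mem_iUnion, exists_prop] using hcover (mem_univ y₁)
  -- `|∫ D(y₁,·) - ∫ D(c,·)| ≤ ε/3`, `|D(y₁,x₂) - D(c,x₂)| < ε/3`, and the centre term
  have h1 : |(∫ y₂, D (y₁, y₂) ∂ν i) - ∫ y₂, D (c, y₂) ∂ν i| ≤ ε / 3 := by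
    have hi1 : Integrable (fun y₂ ↦ D (y₁, y₂)) (ν i) :=
      (hD.comp (continuous_const.prodMk continuous_id)).integrable_of_hasCompactSupport
        (HasCompactSupport.of_compactSpace _)
    have hi2 : Integrable (fun y₂ ↦ D (c, y₂)) (ν i) :=
      (hD.comp (continuous_const.prodMk continuous_id)).integrable_of_hasCompactSupport
        (HasCompactSupport.of_compactSpace _)
    rw [← integral_sub hi1 hi2]
    exact abs_integral_le_of_forall_abs_le _ fun y₂ ↦ (hUε c y₁ hyc y₂).le
  have h2 : |D (y₁, x₂) - D (c, x₂)| < ε / 3 := hUε c y₁ hyc x₂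
  have h3 := hi c hcs
  rw [Real.dist_eq, abs_sub_comm]
  calc |(∫ y₂, D (y₁, y₂) ∂ν i) - D (y₁, x₂)|
      = |((∫ y₂, D (y₁, y₂) ∂ν i) - ∫ y₂, D (c, y₂) ∂ν i) +
          ((∫ y₂, D (c, y₂) ∂ν i) - D (c, x₂)) + (D (c, x₂) - D (y₁, x₂))| := by
        congr 1; ring
    _ ≤ |(∫ y₂, D (y₁, y₂) ∂ν i) - ∫ y₂, D (c, y₂) ∂ν i| +
          |(∫ y₂, D (c, y₂) ∂ν i) - D (c, x₂)| + |D (c, x₂) - D (y₁, x₂)| := abs_add_three _ _ _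
    _ < ε := by rw [abs_sub_comm (D (c, x₂))]; linarith

/-- **`∫∫ Dᵢ dνᵢ dμᵢ → D(x₁, x₂)`** (the limit in the proof of Bamler 2020a, Cor. 9): on a compact space, if the probability measures `μᵢ → δ_{x₁}`, `νᵢ → δ_{x₂}` weakly (against
continuous functions), `D` is continuous and `Dᵢ → D` uniformly on `X × X`, then
`∫ (∫ Dᵢ(y₁, y₂) dνᵢ(y₂)) dμᵢ(y₁) → D(x₁, x₂)`. [folklore] -/
theorem tendsto_integral_integral_of_tendsto_dirac {ι : Type*} {l : Filter ι}
    {μ ν : ι → Measure X} [∀ i, IsProbabilityMeasure (μ i)] [∀ i, IsProbabilityMeasure (ν i)]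
    {x₁ x₂ : X}
    (hμ : ∀ φ : X → ℝ, Continuous φ → Tendsto (fun i ↦ ∫ y, φ y ∂μ i) l (𝓝 (φ x₁)))
    (hν : ∀ φ : X → ℝ, Continuous φ → Tendsto (fun i ↦ ∫ y, φ y ∂ν i) l (𝓝 (φ x₂)))
    {D : X × X → ℝ} (hD : Continuous D) {Di : ι → X × X → ℝ} (hDi : ∀ i, Continuous (Di i))
    (hunif : TendstoUniformly Di D l) :
    Tendsto (fun i ↦ ∫ y₁, ∫ y₂, Di i (y₁, y₂) ∂ν i ∂μ i) l (𝓝 (D (x₁, x₂))) := by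
  rw [Metric.tendsto_nhds]
  intro ε hε
  have hε3 : 0 < ε / 3 := by positivity
  -- (1) `Dᵢ` is uniformly `ε/3`-close to `D`
  have h1 : ∀ᶠ i in l, ∀ q, |Di i q - D q| < ε / 3 := by
    have := (Metric.tendstoUniformly_iff.1 hunif) (ε / 3) hε3
    filter_upwards [this] with i hi q
    rw [abs_sub_comm, ← Real.dist_eq]; exact hi q
  -- (2) the inner integrals of `D` converge uniformly
  have h2 : ∀ᶠ i in l, ∀ y₁, |(∫ y₂, D (y₁, y₂) ∂ν i) - D (y₁, x₂)| < ε / 3 := by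
    have := (Metric.tendstoUniformly_iff.1 (tendstoUniformly_integral_of_tendsto_dirac hν hD))
      (ε / 3) hε3
    filter_upwards [this] with i hi y₁
    rw [abs_sub_comm, ← Real.dist_eq]; exact hi y₁
  -- (3) `∫ D(y₁, x₂) dμᵢ → D(x₁, x₂)`
  have h3 : ∀ᶠ i in l, |(∫ y₁, D (y₁, x₂) ∂μ i) - D (x₁, x₂)| < ε / 3 := by
    have := hμ (fun y₁ ↦ D (y₁, x₂)) (hD.comp (continuous_id.prodMk continuous_const))
    rw [Metric.tendsto_nhds] at this
    simpa only [Real.dist_eq] using this (ε / 3) hε3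
  filter_upwards [h1, h2, h3] with i hi1 hi2 hi3
  -- the inner integrals as continuous functions of `y₁`
  set F : X → ℝ := fun y₁ ↦ ∫ y₂, Di i (y₁, y₂) ∂ν i with hF
  set G : X → ℝ := fun y₁ ↦ ∫ y₂, D (y₁, y₂) ∂ν i with hG
  have hFc : Continuous F := continuous_integral_of_continuous_prod (ν i) (hDi i)
  have hGc : Continuous G := continuous_integral_of_continuous_prod (ν i) hD
  have hint : ∀ {f : X → ℝ}, Continuous f → ∀ (ρ : Measure X) [IsFiniteMeasure ρ], Integrable f ρ :=
    fun hf ρ _ ↦ hf.integrable_of_hasCompactSupport (HasCompactSupport.of_compactSpace _)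
  -- (A) `|∫ F dμ - ∫ G dμ| ≤ ε/3`
  have hFG : ∀ y₁, |F y₁ - G y₁| ≤ ε / 3 := by
    intro y₁
    have hI1 : Integrable (fun y₂ ↦ Di i (y₁, y₂)) (ν i) :=
      hint ((hDi i).comp (continuous_const.prodMk continuous_id)) _
    have hI2 : Integrable (fun y₂ ↦ D (y₁, y₂)) (ν i) :=
      hint (hD.comp (continuous_const.prodMk continuous_id)) _
    simp only [hF, hG]
    rw [← integral_sub hI1 hI2]
    exact abs_integral_le_of_forall_abs_le _ fun y₂ ↦ (hi1 (y₁, y₂)).le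
  have hA : |(∫ y₁, F y₁ ∂μ i) - ∫ y₁, G y₁ ∂μ i| ≤ ε / 3 := by
    rw [← integral_sub (hint hFc _) (hint hGc _)]
    exact abs_integral_le_of_forall_abs_le _ hFG
  -- (B) `|∫ G dμ - ∫ D(·, x₂) dμ| ≤ ε/3`
  have hB : |(∫ y₁, G y₁ ∂μ i) - ∫ y₁, D (y₁, x₂) ∂μ i| ≤ ε / 3 := by
    have hI3 : Integrable (fun y₁ ↦ D (y₁, x₂)) (μ i) :=
      hint (hD.comp (continuous_id.prodMk continuous_const)) _
    rw [← integral_sub (hint hGc _) hI3]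
    exact abs_integral_le_of_forall_abs_le _ fun y₁ ↦ (hi2 y₁).le
  rw [Real.dist_eq]
  show |(∫ y₁, F y₁ ∂μ i) - D (x₁, x₂)| < ε
  calc |(∫ y₁, F y₁ ∂μ i) - D (x₁, x₂)|
      = |((∫ y₁, F y₁ ∂μ i) - ∫ y₁, G y₁ ∂μ i) + ((∫ y₁, G y₁ ∂μ i) - ∫ y₁, D (y₁, x₂) ∂μ i) +
          ((∫ y₁, D (y₁, x₂) ∂μ i) - D (x₁, x₂))| := by congr 1; ring
    _ ≤ |(∫ y₁, F y₁ ∂μ i) - ∫ y₁, G y₁ ∂μ i| + |(∫ y₁, G y₁ ∂μ i) - ∫ y₁, D (y₁, x₂) ∂μ i| +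
          |(∫ y₁, D (y₁, x₂) ∂μ i) - D (x₁, x₂)| := abs_add_three _ _ _
    _ < ε := by linarith

end Literature.MeasureTheory.Integral

end
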